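import Literature.Probability.Process.OptionalStopping
import Literature.Probability.Process.ContinuousHitting
import HarnessLib

/-!
# Optional times and the right-continuous filtration; hitting times of closed sets by adapted versions

Topic `Probability/Process`; theorems only. Two pieces of general plumbing for raw (neither
completed nor right-continuous) filtrations `𝓕` of `ℝ≥0`, consumed by the strong Markov property
of the SLE trace at hitting times (`RandomPlanarGeometry/SLETraceHittingMarkov.lean`).

* **Optional times are the stopping times of `𝓕₊`.** `Literature.Probability.Process.IsOptionalTime`
  (`{ρ < t} ∈ 𝓕 t` for all `t`, `StoppedMartingale.lean`) is equivalent to Mathlib's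
  `IsStoppingTime 𝓕.rightCont ρ` for the right-continuous regularisation
  `MeasureTheory.Filtration.rightCont` (`isOptionalTime_iff_isStoppingTime_rightCont`), so that
  Mathlib's σ-algebra `IsStoppingTime.measurableSpace` of a `𝓕₊`-stopping time serves as the
  σ-algebra `𝓕_{ρ+}` of the past up to an optional time; its events `A` satisfy
  `A ∩ {ρ < t} ∈ 𝓕 t` (`measurableSet_inter_lt_of_rightCont`) and therefore belong to the RAW
  stopping-time σ-algebras of the dyadic upper approximations `dyadicCeilTop n ρ`
  (`measurableSet_dyadicCeilTop_of_rightCont`) — the input of every "approximate from above and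
  pass to the limit" argument (Le Gall (2016), proof of Thm. 2.20; Revuz–Yor (1999), Ch. I §4).
* **Hitting times of closed sets by an adapted version of a continuous process are a.s. optional.**
  If `Y` is adapted and agrees at all times with the continuous path `u(·, ω)` for the good `ω`
  (think: `u` has a.s. continuous paths but is only a.e. defined, `Y` an adapted version), then
  there is an optional time `σ` of `𝓕` with `σ ω = hittingAfter u s 0 ω` for every good `ω`
  (`exists_isOptionalTime_eq_hittingAfter`, closed `s`): `σ = inf {r ∈ D : ω ∈ H_r}` over a
  countable dense `D`, with `H_r = ⋂ₙ ⋃_{q ∈ D_r} {infDist (Y q) s < 1/(n+1)} ∈ 𝓕 r` the countable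
  description of `{τ ≤ r}` (`exists_le_mem_iff_forall_exists_infDist_lt`).

## References

* J.-F. Le Gall, *Brownian Motion, Martingales, and Stochastic Calculus* (2016), §3.3 (stopping
  times of `(𝓕ₜ₊)`, Prop. 3.8–3.9) and Thm. 2.20.
* D. Revuz, M. Yor, *Continuous Martingales and Brownian Motion* (1999), Ch. I, §4,
  Def. (4.1)–Prop. (4.6).
-/

noncomputable section

open MeasureTheory Filter Set Metric
open scoped NNReal Topology

namespace Literature.Probability.Process

variable {Ω : Type*} {m : MeasurableSpace Ω} {𝓕 : Filtration ℝ≥0 m} {σ : Ω → WithTop ℝ≥0}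

/-! ### Optional times and `𝓕₊` -/

/-- `𝓕₊ s ≤ 𝓕 t` for `s < t` (`𝓕₊ s = ⨅_{j > s} 𝓕 j`, Mathlib `Filtration.rightCont_eq`).
[folklore] -/
theorem rightCont_le_of_lt (𝓕 : Filtration ℝ≥0 m) {s t : ℝ≥0} (hst : s < t) :
    𝓕.rightCont s ≤ 𝓕 t := by
  rw [Filtration.rightCont_eq]
  exact iInf₂_le t hst

/-- **An optional time of `𝓕` is a stopping time of `𝓕₊`** (Mathlib's
`isStoppingTime_of_measurableSet_lt_of_isRightContinuous` for the right-continuous filtration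
`𝓕₊`). Le Gall (2016), Prop. 3.9 (i). [folklore] -/
theorem IsOptionalTime.isStoppingTime_rightCont (hσ : IsOptionalTime 𝓕 σ) :
    IsStoppingTime 𝓕.rightCont σ :=
  isStoppingTime_of_measurableSet_lt_of_isRightContinuous fun t ↦ 𝓕.le_rightCont t _ (hσ t)

/-- **Events of the past up to a `𝓕₊`-stopping time, before `t`, are `𝓕 t`-events**: for
`A ∈ 𝓕_{σ+}` (Mathlib's `hσ.measurableSpace`), `A ∩ {σ < t} ∈ 𝓕 t`
(`A ∩ {σ < t} = ⋃ₙ A ∩ {σ ≤ uₙ}` along `uₙ ↑ t`, `uₙ < t`, and `A ∩ {σ ≤ uₙ} ∈ 𝓕₊ uₙ ⊆ 𝓕 t`).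
Revuz–Yor (1999), Ch. I, §4. [folklore] -/
theorem measurableSet_inter_lt_of_rightCont (hσ : IsStoppingTime 𝓕.rightCont σ) {A : Set Ω}
    (hA : MeasurableSet[hσ.measurableSpace] A) (t : ℝ≥0) :
    MeasurableSet[𝓕 t] (A ∩ {ω | σ ω < t}) := by
  rcases eq_or_ne t 0 with rfl | ht
  · have hset : A ∩ {ω | σ ω < ((0 : ℝ≥0) : WithTop ℝ≥0)} = ∅ := by
      ext ω
      simp only [mem_inter_iff, mem_setOf_eq, mem_empty_iff_false, iff_false, not_and, not_lt]
      exact fun _ ↦ bot_le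
    rw [hset]
    exact @MeasurableSet.empty _ (𝓕 0)
  · obtain ⟨u, -, hu_mem, hu_lim⟩ := exists_seq_strictMono_tendsto' (pos_iff_ne_zero.2 ht)
    have hset : A ∩ {ω | σ ω < t} = ⋃ n, A ∩ {ω | σ ω ≤ u n} := by
      ext ω
      simp only [mem_inter_iff, mem_setOf_eq, mem_iUnion]
      constructor
      · rintro ⟨hωA, hlt⟩
        obtain ⟨r, hr⟩ := WithTop.ne_top_iff_exists.1 (ne_top_of_lt hlt)
        rw [← hr, WithTop.coe_lt_coe] at hlt
        obtain ⟨n, hn⟩ := (hu_lim.eventually (lt_mem_nhds hlt)).exists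
        exact ⟨n, hωA, by rw [← hr]; exact WithTop.coe_le_coe.2 hn.le⟩
      · rintro ⟨n, hωA, hle⟩
        exact ⟨hωA, hle.trans_lt (WithTop.coe_lt_coe.2 (hu_mem n).2)⟩
    rw [hset]
    exact MeasurableSet.iUnion fun n ↦ rightCont_le_of_lt 𝓕 (hu_mem n).2 _ (hA.2 (u n))

/-- A stopping time of `𝓕₊` is an optional time of `𝓕`. Le Gall (2016), Prop. 3.9 (i).
[folklore] -/
theorem isOptionalTime_of_rightCont (hσ : IsStoppingTime 𝓕.rightCont σ) : IsOptionalTime 𝓕 σ := by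
  intro t
  have h := measurableSet_inter_lt_of_rightCont hσ (@MeasurableSet.univ _ hσ.measurableSpace) t
  rwa [univ_inter] at h

/-- **Optional times of `𝓕` are exactly the stopping times of `𝓕₊`.** Le Gall (2016),
Prop. 3.9 (i); Revuz–Yor (1999), Ch. I, §4. [folklore] -/
theorem isOptionalTime_iff_isStoppingTime_rightCont :
    IsOptionalTime 𝓕 σ ↔ IsStoppingTime 𝓕.rightCont σ :=
  ⟨IsOptionalTime.isStoppingTime_rightCont, isOptionalTime_of_rightCont⟩

/-- The dyadic upper approximations of a `𝓕₊`-stopping time are (raw) `𝓕`-stopping times.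
Le Gall (2016), Prop. 3.8. [folklore] -/
theorem isStoppingTime_dyadicCeilTop_of_rightCont (hσ : IsStoppingTime 𝓕.rightCont σ) (n : ℕ) :
    IsStoppingTime 𝓕 fun ω ↦ dyadicCeilTop n (σ ω) :=
  (isOptionalTime_of_rightCont hσ).isStoppingTime_dyadicCeilTop n

/-- **`𝓕_{σ+} ⊆ 𝓕_{σₙ}`**: an event of the past up to the `𝓕₊`-stopping time `σ` belongs to the
raw stopping-time σ-algebra of each dyadic upper approximation `σₙ = dyadicCeilTop n σ`
(`A ∩ {σₙ ≤ t} = A ∩ {σ < ⌊2ⁿt⌋2⁻ⁿ} ∈ 𝓕_{⌊2ⁿt⌋2⁻ⁿ} ⊆ 𝓕 t`). Le Gall (2016), proof of Thm. 2.20.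
[folklore] -/
theorem measurableSet_dyadicCeilTop_of_rightCont (hσ : IsStoppingTime 𝓕.rightCont σ) {A : Set Ω}
    (hA : MeasurableSet[hσ.measurableSpace] A) (n : ℕ) :
    MeasurableSet[(isStoppingTime_dyadicCeilTop_of_rightCont hσ n).measurableSpace] A := by
  refine ⟨hA.1, fun t ↦ ?_⟩
  have hset : A ∩ {ω | dyadicCeilTop n (σ ω) ≤ (t : WithTop ℝ≥0)} =
      A ∩ {ω | σ ω < ((((⌊t * 2 ^ n⌋₊ : ℕ) : ℝ≥0) / 2 ^ n : ℝ≥0) : WithTop ℝ≥0)} := by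
    ext ω
    simp only [mem_inter_iff, mem_setOf_eq, dyadicCeilTop_le_coe_iff]
  rw [hset]
  exact 𝓕.mono (floorGrid_le n t) _ (measurableSet_inter_lt_of_rightCont hσ hA _)

/-- A `𝓕₊`-stopping time is `𝓕_{σ+}`-measurable (Mathlib `IsStoppingTime.measurable`), recorded
in the form consumed downstream: `{σ ∈ B} ∈ 𝓕_{σ+}` for Borel `B`. [folklore] -/
theorem measurableSet_preimage_of_rightCont (hσ : IsStoppingTime 𝓕.rightCont σ)
    {B : Set (WithTop ℝ≥0)} (hB : MeasurableSet B) :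
    MeasurableSet[hσ.measurableSpace] (σ ⁻¹' B) :=
  hσ.measurable hB

/-! ### Hitting times of closed sets by an adapted version of a continuous process -/

section Hitting

variable {E : Type*} [PseudoMetricSpace E] [MeasurableSpace E] [OpensMeasurableSpace E]

/-- **The hitting time of a closed set, computed from an adapted version, is optional.** Let
`Y : ℝ≥0 → Ω → E` be adapted to `𝓕` and `s` closed. There is an optional time `σ` of `𝓕` such
that `σ ω` is the first hitting time of `s` by the path `u(·, ω)` for every `ω` at which this
path is continuous and agrees with `Y(·, ω)` at all times. Construction: `D` a countable dense
subset of `ℝ≥0`, `D_r` of `[0, r]`; `H_r = ⋂ₙ ⋃_{q ∈ D_r} {infDist (Y q) s < 1/(n+1)} ∈ 𝓕 r`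
equals `{τ ≤ r}` at good `ω` (`hittingAfter_zero_le_coe_iff`,
`exists_le_mem_iff_forall_exists_infDist_lt`), and `σ = inf {r ∈ D : H_r}` has
`{σ < t} = ⋃_{r ∈ D, r < t} H_r ∈ 𝓕 t`. (For `s = ∅`, `σ = τ = ⊤`.) Revuz–Yor (1999), Ch. I, §4,
Prop. (4.6) and the remarks on `𝓕₊` following Def. (4.1). [cite: RevuzYor1999, Ch. I Prop. (4.6)] -/
theorem exists_isOptionalTime_eq_hittingAfter {u Y : ℝ≥0 → Ω → E}
    (hY : ∀ t, Measurable[𝓕 t] (Y t)) {s : Set E} (hs : IsClosed s) :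
    ∃ σ : Ω → WithTop ℝ≥0, IsOptionalTime 𝓕 σ ∧
      ∀ ω, Continuous (fun t ↦ u t ω) → (∀ t, Y t ω = u t ω) → σ ω = hittingAfter u s 0 ω := by
  classical
  rcases s.eq_empty_or_nonempty with rfl | hne
  · refine ⟨fun _ ↦ ⊤, fun t ↦ ?_, fun ω _ _ ↦ ?_⟩
    · have : {ω : Ω | (⊤ : WithTop ℝ≥0) < t} = ∅ := by ext ω; simp
      rw [this]
      exact @MeasurableSet.empty _ (𝓕 t)
    · exact (hittingAfter_zero_apply_of_forall fun j ↦ notMem_empty _).symm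
  obtain ⟨D₀, hD₀c, hD₀d⟩ := TopologicalSpace.exists_countable_dense ℝ≥0
  have hD : ∀ r : ℝ≥0, ∃ D : Set (Iic r), D.Countable ∧ Dense D := fun r ↦
    TopologicalSpace.exists_countable_dense _
  choose D hDc hDd using hD
  -- the events `H r ∈ 𝓕 r`
  set H : ℝ≥0 → Set Ω := fun r ↦
    {ω | ∀ n : ℕ, ∃ q ∈ D r, infDist (Y (q : ℝ≥0) ω) s < 1 / ((n : ℝ) + 1)} with hH
  have hHm : ∀ r, MeasurableSet[𝓕 r] (H r) := by
    intro r
    have h : H r = ⋂ n : ℕ, ⋃ q ∈ D r, {ω | infDist (Y (q : ℝ≥0) ω) s < 1 / ((n : ℝ) + 1)} := by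
      ext ω; simp only [hH, mem_setOf_eq, mem_iInter, mem_iUnion, exists_prop]
    rw [h]
    refine MeasurableSet.iInter fun n ↦ MeasurableSet.biUnion (hDc r) fun q _ ↦ ?_
    have hm : Measurable[𝓕 r] (Y (q : ℝ≥0)) := (hY (q : ℝ≥0)).mono (𝓕.mono q.2) le_rfl
    exact measurableSet_lt ((continuous_infDist_pt s).measurable.comp hm) measurable_const
  -- at good `ω`, `H r` is `{τ ≤ r}`
  have hHiff : ∀ ω, Continuous (fun t ↦ u t ω) → (∀ t, Y t ω = u t ω) →
      ∀ r, (ω ∈ H r ↔ hittingAfter u s 0 ω ≤ r) := by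
    intro ω hc hYu r
    rw [hittingAfter_zero_le_coe_iff hs hc,
      exists_le_mem_iff_forall_exists_infDist_lt hs hne hc (hDd r)]
    simp only [hH, mem_setOf_eq, hYu]
  refine ⟨fun ω ↦ sInf {x : WithTop ℝ≥0 | ∃ r ∈ D₀, ω ∈ H r ∧ x = r}, fun t ↦ ?_,
    fun ω hc hYu ↦ ?_⟩
  · -- `{σ < t} = ⋃_{r ∈ D₀, r < t} H r ∈ 𝓕 t`
    have hset : {ω | sInf {x : WithTop ℝ≥0 | ∃ r ∈ D₀, ω ∈ H r ∧ x = r} < (t : WithTop ℝ≥0)} =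
        ⋃ r ∈ D₀, ⋃ (_ : r < t), H r := by
      ext ω
      rw [mem_setOf_eq]
      constructor
      · intro h
        obtain ⟨x, ⟨r, hrD, hωr, rfl⟩, hxt⟩ := sInf_lt_iff.1 h
        exact mem_iUnion₂.2 ⟨r, hrD, mem_iUnion.2 ⟨WithTop.coe_lt_coe.1 hxt, hωr⟩⟩
      · intro h
        obtain ⟨r, hrD, hr⟩ := mem_iUnion₂.1 h
        obtain ⟨hrt, hωr⟩ := mem_iUnion.1 hr
        exact sInf_lt_iff.2 ⟨r, ⟨r, hrD, hωr, rfl⟩, WithTop.coe_lt_coe.2 hrt⟩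
    rw [hset]
    exact MeasurableSet.biUnion hD₀c fun r _ ↦ MeasurableSet.iUnion fun hrt ↦
      𝓕.mono hrt.le _ (hHm r)
  · -- `σ = τ` at good `ω`
    dsimp only
    have hS : {x : WithTop ℝ≥0 | ∃ r ∈ D₀, ω ∈ H r ∧ x = r} =
        {x : WithTop ℝ≥0 | ∃ r ∈ D₀, hittingAfter u s 0 ω ≤ r ∧ x = r} := by
      ext x
      simp only [mem_setOf_eq, hHiff ω hc hYu]
    rw [hS]
    apply le_antisymm
    · refine le_of_forall_gt_imp_ge_of_dense fun a ha ↦ ?_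
      induction a using WithTop.recTopCoe with
      | top => exact le_top
      | coe a =>
        obtain ⟨T, hT⟩ := WithTop.ne_top_iff_exists.1 (ne_top_of_lt ha)
        rw [← hT, WithTop.coe_lt_coe] at ha
        obtain ⟨r, hrD, hr⟩ := hD₀d.exists_between ha
        refine sInf_le_of_le ⟨r, hrD, ?_, rfl⟩ (WithTop.coe_le_coe.2 hr.2.le)
        rw [← hT]
        exact WithTop.coe_le_coe.2 hr.1.le
    · exact le_sInf fun x ⟨r, _, hr, hx⟩ ↦ by rw [hx]; exact hr

end Hitting

end Literature.Probability.Process
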